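import Literature.Probability.Percolation.PlanarDuality
import Literature.Probability.LatticeModels.HoleFreePotential
import Literature.Probability.LatticeModels.LatticeDobrushinDomain
import HarnessLib

/-!
# Lattice walks in `ℤ²`: first hits, sub-walks spanning a slab, and face paths

Topic `Literature/Probability/LatticeModels`; an instalment (item P5 of the road recorded in
`Sweep1Proofs.lean`, module docstring §2b) of the discharge programme for crit-ising.S18 /
Smirnov's Theorem 2.2. Walk surgery used by the topological half of the weak Beurling estimate
(`AnnulusManeuver.lean`): the first vertex of a walk satisfying a predicate
(`exists_prefix_first`), the sub-walk of a walk from `xᵢ ≤ L` to `xᵢ ≥ R` that spans the slab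
`L ≤ xᵢ ≤ R` exactly (`exists_subwalk_slab`, the input format of the crossing lemma
`Percolation.exists_mem_support_of_crossing`), the conversion of chains of face steps (`HoleFree`)
into walks (`exists_walk_of_faceStep`), and the fact that a walk escaping from the box of radius
`B₁` to outside the box of radius `B₃` crosses one of the four strips of the square frame
transversally (`exists_strip_crossing`). Everything is proved and `[folklore]`.
-/

noncomputable section

namespace Literature.Probability.LatticeModels

open SimpleGraph Set

/-! ### First hit of a predicate along a walk -/

/-- **First hit.** Along a walk from `u` to `v` with `P v`, there is a prefix ending at the first
vertex `v'` satisfying `P`: all other vertices of the prefix fail `P`, and (unless the prefix is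
trivial) the vertex before `v'` is adjacent to it and fails `P`. [folklore] -/
theorem exists_prefix_first {u v : Site 2} (p : (zdGraph 2).Walk u v) (P : Site 2 → Prop) [DecidablePred P]
    (hv : P v) :
    ∃ (v' : Site 2) (q : (zdGraph 2).Walk u v'), P v' ∧ (∀ z ∈ q.support, P z → z = v') ∧
      (∀ z ∈ q.support, z ∈ p.support) ∧ (u = v' ∨ ∃ z ∈ q.support, (zdGraph 2).Adj z v' ∧ ¬ P z) := by
  induction p with
  | nil => exact ⟨_, Walk.nil, hv, fun z hz _ => by simpa using hz, fun z hz => hz, Or.inl rfl⟩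
  | @cons a b c hadj p ih =>
    by_cases ha : P a
    · exact ⟨a, Walk.nil, ha, fun z hz _ => by simpa using hz, fun z hz => by
        simp only [Walk.support_nil, List.mem_singleton] at hz; subst hz; simp, Or.inl rfl⟩
    · obtain ⟨v', q, hPv', hq, hsub, hlast⟩ := ih hv
      refine ⟨v', Walk.cons hadj q, hPv', fun z hz hPz => ?_, fun z hz => ?_, Or.inr ?_⟩
      · rw [Walk.support_cons, List.mem_cons] at hz
        rcases hz with rfl | hz
        · exact (ha hPz).elim
        · exact hq z hz hPz
      · rw [Walk.support_cons, List.mem_cons] at hz ⊢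
        rcases hz with rfl | hz
        · exact Or.inl rfl
        · exact Or.inr (hsub z hz)
      · rcases hlast with rfl | ⟨z, hz, hadj', hPz⟩
        · exact ⟨a, by simp, hadj, ha⟩
        · exact ⟨z, by rw [Walk.support_cons]; exact List.mem_cons_of_mem _ hz, hadj', hPz⟩

/-! ### Sub-walks spanning a coordinate slab -/

/-- **A walk from below `L` to above `R` in coordinate `i` contains a sub-walk spanning the slab
`L ≤ xᵢ ≤ R` exactly**: starting on `xᵢ = L`, ending on `xᵢ = R`, staying in the slab, with
support inside the original support. [folklore] -/
theorem exists_subwalk_slab {u v : Site 2} (p : (zdGraph 2).Walk u v) (i : Fin 2) {L R : ℤ}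
    (hu : u i ≤ L) (hv : R ≤ v i) (hLR : L ≤ R) :
    ∃ (u' v' : Site 2) (q : (zdGraph 2).Walk u' v'), u' i = L ∧ v' i = R ∧
      (∀ z ∈ q.support, z ∈ p.support) ∧ ∀ z ∈ q.support, L ≤ z i ∧ z i ≤ R := by
  classical
  -- first hit of `R ≤ xᵢ`
  obtain ⟨v', q₁, hv'R, hq₁, hsub₁, hlast₁⟩ := exists_prefix_first p (fun z => R ≤ z i) hv
  have hv'eq : v' i = R := by
    rcases hlast₁ with rfl | ⟨z, hz, hadj, hPz⟩
    · exact le_antisymm (by linarith) hv'R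
    · have h1 := abs_sub_le_one_of_adj hadj i
      push Not at hPz
      rw [abs_le] at h1
      linarith [h1.1, h1.2]
  have hq₁' : ∀ z ∈ q₁.support, z i ≤ R := by
    intro z hz
    by_cases h : R ≤ z i
    · rw [hq₁ z hz h, hv'eq]
    · push Not at h; exact h.le
  -- first hit of `xᵢ ≤ L` along the reversed prefix
  obtain ⟨u', q₂, hu'L, hq₂, hsub₂, hlast₂⟩ := exists_prefix_first q₁.reverse (fun z => z i ≤ L) hu
  have hu'eq : u' i = L := by
    rcases hlast₂ with rfl | ⟨z, hz, hadj, hPz⟩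
    · -- `v' = u'`: `R = v' i ≤ L`
      linarith
    · have h1 := abs_sub_le_one_of_adj hadj i
      push Not at hPz
      rw [abs_le] at h1
      linarith [h1.1, h1.2]
  refine ⟨u', v', q₂.reverse, hu'eq, hv'eq, fun z hz => ?_, fun z hz => ⟨?_, ?_⟩⟩
  · rw [Walk.support_reverse, List.mem_reverse] at hz
    have := hsub₂ z hz
    rw [Walk.support_reverse, List.mem_reverse] at this
    exact hsub₁ z this
  · rw [Walk.support_reverse, List.mem_reverse] at hz
    by_cases h : z i ≤ L
    · rw [hq₂ z hz h, hu'eq]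
    · push Not at h; exact h.le
  · rw [Walk.support_reverse, List.mem_reverse] at hz
    have := hsub₂ z hz
    rw [Walk.support_reverse, List.mem_reverse] at this
    exact hq₁' z this

/-! ### Face paths as walks -/

/-- A chain of face steps avoiding `P` is a lattice walk with support off `P`. [folklore] -/
theorem exists_walk_of_faceStep {P : Set (Site 2)} {g g' : Site 2} (h : Relation.ReflTransGen (FaceStep P) g g')
    (hg : g ∉ P) :
    ∃ q : (zdGraph 2).Walk g g', ∀ z ∈ q.support, z ∉ P := by
  induction h with
  | refl => exact ⟨Walk.nil, fun z hz => by simp only [Walk.support_nil, List.mem_singleton] at hz; subst hz; exact hg⟩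
  | @tail b c _ hbc ih =>
    obtain ⟨q, hq⟩ := ih
    refine ⟨q.append (Walk.cons hbc.1 Walk.nil), fun z hz => ?_⟩
    rw [Walk.support_append, List.mem_append] at hz
    rcases hz with hz | hz
    · exact hq z hz
    · simp only [Walk.support_cons, Walk.support_nil, List.tail_cons, List.mem_singleton] at hz
      subst hz; exact hbc.2.2

/-! ### The frame-crossing contradiction -/

/-- **Escaping face paths cross the frame.** Let `γ` be a lattice walk from a site within
sup-distance `n₁` of `c` to a site at sup-distance `≥ n₃` from `c` in some coordinate direction…
concretely with `|g₀ - c₀|, |g₁ - c₁| ≤ B₁` at the start and the end outside the open box of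
radius `B₃ > B₁` about `c`. Then `γ` contains a sub-walk which is a transversal crossing of one of
the four strips of the square frame `B₁ ≤ ‖· - c‖_∞ ≤ B₃`: staying in the strip, it joins its
inner edge to its outer edge. [folklore] -/
theorem exists_strip_crossing {c g g' : Site 2} {B₁ B₃ : ℤ} (hB : B₁ ≤ B₃) (γ : (zdGraph 2).Walk g g')
    (hg : |g 0 - c 0| ≤ B₁ ∧ |g 1 - c 1| ≤ B₁)
    (hg' : B₃ ≤ |g' 0 - c 0| ∨ B₃ ≤ |g' 1 - c 1|) :
    ∃ (u v : Site 2) (σ : (zdGraph 2).Walk u v), (∀ z ∈ σ.support, z ∈ γ.support) ∧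
      ((-- top strip, bottom-to-top
        u 1 = c 1 + B₁ ∧ v 1 = c 1 + B₃ ∧ ∀ z ∈ σ.support, c 0 - B₃ ≤ z 0 ∧ z 0 ≤ c 0 + B₃ ∧ c 1 + B₁ ≤ z 1 ∧ z 1 ≤ c 1 + B₃) ∨
       (-- bottom strip, top-to-bottom (stated bottom-up after reversal by the user)
        u 1 = c 1 - B₃ ∧ v 1 = c 1 - B₁ ∧ ∀ z ∈ σ.support, c 0 - B₃ ≤ z 0 ∧ z 0 ≤ c 0 + B₃ ∧ c 1 - B₃ ≤ z 1 ∧ z 1 ≤ c 1 - B₁) ∨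
       (-- right strip
        u 0 = c 0 + B₁ ∧ v 0 = c 0 + B₃ ∧ ∀ z ∈ σ.support, c 0 + B₁ ≤ z 0 ∧ z 0 ≤ c 0 + B₃ ∧ c 1 - B₃ ≤ z 1 ∧ z 1 ≤ c 1 + B₃) ∨
       (-- left strip
        u 0 = c 0 - B₃ ∧ v 0 = c 0 - B₁ ∧ ∀ z ∈ σ.support, c 0 - B₃ ≤ z 0 ∧ z 0 ≤ c 0 - B₁ ∧ c 1 - B₃ ≤ z 1 ∧ z 1 ≤ c 1 + B₃)) := by
  classical
  -- first exit from the open box of radius `B₃`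
  obtain ⟨v', q, hPv', hq, hsub, hlast⟩ := exists_prefix_first γ (fun z => B₃ ≤ |z 0 - c 0| ∨ B₃ ≤ |z 1 - c 1|) hg'
  -- all vertices of `q` other than `v'` are strictly inside; `v'` is within `B₃` in both coordinates
  have hin : ∀ z ∈ q.support, z ≠ v' → |z 0 - c 0| < B₃ ∧ |z 1 - c 1| < B₃ := by
    intro z hz hne
    by_contra h
    rw [not_and_or, not_lt, not_lt] at h
    exact hne (hq z hz h)
  have hv'in : |v' 0 - c 0| ≤ B₃ ∧ |v' 1 - c 1| ≤ B₃ := by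
    rcases hlast with rfl | ⟨z, hz, hadj, hPz⟩
    · exact ⟨hg.1.trans hB, hg.2.trans hB⟩
    · push Not at hPz
      have h0 := abs_sub_le_one_of_adj hadj 0
      have h1 := abs_sub_le_one_of_adj hadj 1
      rw [abs_le] at h0 h1
      obtain ⟨hz0, hz1⟩ := hPz
      rw [abs_lt] at hz0 hz1
      constructor <;> rw [abs_le] <;> constructor <;> linarith [h0.1, h0.2, h1.1, h1.2]
  have hall : ∀ z ∈ q.support, |z 0 - c 0| ≤ B₃ ∧ |z 1 - c 1| ≤ B₃ := by
    intro z hz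
    by_cases hne : z = v'
    · rw [hne]; exact hv'in
    · exact ⟨(hin z hz hne).1.le, (hin z hz hne).2.le⟩
  -- case analysis on the exit side
  rcases hPv' with h0 | h1
  · -- exit through a vertical side: `|v'₀ - c₀| = B₃`
    have heq : |v' 0 - c 0| = B₃ := le_antisymm hv'in.1 h0
    rcases le_or_gt 0 (v' 0 - c 0) with hpos | hneg
    · -- right side: `v'₀ = c₀ + B₃`; sub-walk in coordinate `0` from `c₀ + B₁` to `c₀ + B₃`
      rw [abs_of_nonneg hpos] at heq
      obtain ⟨u, v, σ, hu, hv, hσsub, hσ⟩ := exists_subwalk_slab q 0 (L := c 0 + B₁) (R := c 0 + B₃)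
        (by have := hg.1; rw [abs_le] at this; linarith [this.2]) (by linarith) (by linarith)
      refine ⟨u, v, σ, fun z hz => hsub z (hσsub z hz), Or.inr (Or.inr (Or.inl ⟨hu, hv, fun z hz => ?_⟩))⟩
      have h := hσ z hz; have h' := (hall z (hσsub z hz)).2; rw [abs_le] at h'
      exact ⟨h.1, h.2, by linarith [h'.1], by linarith [h'.2]⟩
    · -- left side: `v'₀ = c₀ - B₃`; use the reversed prefix, coordinate `0` from `c₀ - B₃` to `c₀ - B₁`
      rw [abs_of_neg hneg] at heq
      obtain ⟨u, v, σ, hu, hv, hσsub, hσ⟩ := exists_subwalk_slab q.reverse 0 (L := c 0 - B₃) (R := c 0 - B₁)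
        (by linarith) (by have := hg.1; rw [abs_le] at this; linarith [this.1]) (by linarith)
      refine ⟨u, v, σ, fun z hz => hsub z ?_, Or.inr (Or.inr (Or.inr ⟨hu, hv, fun z hz => ?_⟩))⟩
      · have := hσsub z hz; rwa [Walk.support_reverse, List.mem_reverse] at this
      · have h := hσ z hz
        have hz' : z ∈ q.support := by have := hσsub z hz; rwa [Walk.support_reverse, List.mem_reverse] at this
        have h' := (hall z hz').2; rw [abs_le] at h'
        exact ⟨h.1, h.2, by linarith [h'.1], by linarith [h'.2]⟩
  · have heq : |v' 1 - c 1| = B₃ := le_antisymm hv'in.2 h1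
    rcases le_or_gt 0 (v' 1 - c 1) with hpos | hneg
    · -- top
      rw [abs_of_nonneg hpos] at heq
      obtain ⟨u, v, σ, hu, hv, hσsub, hσ⟩ := exists_subwalk_slab q 1 (L := c 1 + B₁) (R := c 1 + B₃)
        (by have := hg.2; rw [abs_le] at this; linarith [this.2]) (by linarith) (by linarith)
      refine ⟨u, v, σ, fun z hz => hsub z (hσsub z hz), Or.inl ⟨hu, hv, fun z hz => ?_⟩⟩
      have h := hσ z hz; have h' := (hall z (hσsub z hz)).1; rw [abs_le] at h'
      exact ⟨by linarith [h'.1], by linarith [h'.2], h.1, h.2⟩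
    · -- bottom
      rw [abs_of_neg hneg] at heq
      obtain ⟨u, v, σ, hu, hv, hσsub, hσ⟩ := exists_subwalk_slab q.reverse 1 (L := c 1 - B₃) (R := c 1 - B₁)
        (by linarith) (by have := hg.2; rw [abs_le] at this; linarith [this.1]) (by linarith)
      refine ⟨u, v, σ, fun z hz => hsub z ?_, Or.inr (Or.inl ⟨hu, hv, fun z hz => ?_⟩)⟩
      · have := hσsub z hz; rwa [Walk.support_reverse, List.mem_reverse] at this
      · have h := hσ z hz
        have hz' : z ∈ q.support := by have := hσsub z hz; rwa [Walk.support_reverse, List.mem_reverse] at this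
        have h' := (hall z hz').1; rw [abs_le] at h'
        exact ⟨by linarith [h'.1], by linarith [h'.2], h.1, h.2⟩

end Literature.Probability.LatticeModels
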